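import Mathlib
import Summits.Ventures.PercRepro2.HCov
import Summits.Ventures.PercRepro2.PendantA3Pins
import Summits.Ventures.PercRepro2.RootEdgeBern
import Summits.Ventures.PercRepro2.HCovPlusQuartic
import Summits.Ventures.PercRepro2.QuarticRootCross
import Summits.Ventures.PercRepro2.QuarticRootCrossOL

/-!
# THE ROOT-EDGE FACE OF THE QUARTIC ROAD, REDUCED TO THREE CLOSED-PIN INEQUALITIES
(blind cell PercRepro2, p5 g18; `proofs/P5-OEDGE.md` §24)

At a root edge `e = {a₁, a₃}` the quartic's open face is `0 ≤ H1 ∧ 0 ≤ H2` with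
`H1 = Q₀·B1 + Q₁·Gc₀ + covU₀·slackBm + c·slackB₀` and `H2 = Q₀·B2 + Q₁·B1 + c·slackBm`
(`HCovPlusQuartic.H1_eq_root` / `H2_eq_root`), where the cross term `c = covUm` satisfies
`c ≥ −δ_oH` (`QuarticRootCrossOL.covUm_root_add_oH_deficit_nonneg`),
`δ_oH = P₀(PD, oH)·P₀(T′) − D₀·P₀(T′, oH) ≥ 0` the `oH` anti-correlation deficit of the closed pin.
Since `B2 ≥ 0` (`RootEdge.B2_nonneg_root`) and `slackB₀ ≥ 0` (`PendantA3.slack_nonneg`):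

* **`H2_nonneg_root_of`**: `0 ≤ slackBm` and `δ_oH·slackBm ≤ Q₁·B1` give `0 ≤ H2`;
* **`H1_nonneg_root_of`**: `0 ≤ Q₀·B1 + covU₀·slackBm` and `δ_oH·slackB₀ ≤ Q₁·Gc₀` give `0 ≤ H1`;
* **`HCovPlus_of_update_zero_root_of`**: (HCOV⁺) at the closed pin and the three closed-pin
  inequalities give (HCOV⁺) at `p` — the root-edge face of `JointGood` is exactly
  «`0 ≤ slackBm` ∧ `δ_oH·slackBm ≤ Q₁·B1` ∧ `0 ≤ Q₀·B1 + covU₀·slackBm` ∧ `δ_oH·slackB₀ ≤ Q₁·Gc₀`»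
  (each census-true: 0 violations on 1,650 / 1,650 / 600 / 600 random root-edge instances, §24;
  none a theorem).

The third and fourth are the `oH`-deficit margins: `δ_oH·slackB₀ ≤ Q₁·Gc₀` says that (HCOV) at the
closed pin holds with the margin `(δ_oH / Q₁)·slackB` — the single-instance statement (S1) of §24,
`Q₁·Gc ≥ δ_oH·slackB` with `Q₁ = D + P(T′)`, census-true on 1,200 / 1,200 random instances.
-/

namespace Summit.Ventures.PercRepro2

open UnionCluster CovForm CovForm.EdgeLine CovForm.RootEdge PendantA3 CPolarSubPlus HCovPlusQuartic

namespace QuarticRootCross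

section Face

variable {V : Type*} {E : Type*} [Fintype V] [DecidableEq V] [Fintype E] [DecidableEq E]
  {R : Type*} [Field R] [LinearOrder R] [IsStrictOrderedRing R]

variable {ends : E → Sym2 V} {e : E} {a₁ a₃ : V}

/-- `slackB ≥ 0` at every weight vector (`PendantA3.slack_nonneg` read on `slackB`). -/
lemma slackB_nonneg (p : E → R) (hp : IsProbVec p) (ends : E → Sym2 V) (a₁ a₂ a₃ b : V) :
    0 ≤ slackB p ends a₁ a₂ a₃ b := by
  rw [slackB_eq]
  unfold Qb
  exact PendantA3.slack_nonneg p hp ends a₁ a₂ a₃ b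

/-- **`0 ≤ H2` at a root edge from two closed-pin inequalities**: `0 ≤ slackBm` and
`δ_oH·slackBm ≤ Q₁·B1` (with `c ≥ −δ_oH` and `B2 ≥ 0` theorems). -/
theorem H2_nonneg_root_of (p : E → R) (hp : IsProbVec p) (hends : ends e = s(a₁, a₃)) (o a₂ b : V)
    (hsm : 0 ≤ slackBm p ends a₁ a₂ a₃ b e)
    (hC2 : (prob (Function.update p e 0) (PDEvent ends a₁ a₂ a₃ ∩ connEvent ends a₂ o) *
              prob (Function.update p e 0) (TEvent ends a₂ a₁ a₃) -
            prob (Function.update p e 0) (PDEvent ends a₁ a₂ a₃) *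
              prob (Function.update p e 0) (TEvent ends a₂ a₁ a₃ ∩ connEvent ends a₂ o)) *
          slackBm p ends a₁ a₂ a₃ b e ≤
        prob (Function.update p e 1) (avoidAll ends a₂ {a₁}) * B1 p ends o a₁ a₂ a₃ b e) :
    0 ≤ H2 p ends o a₁ a₂ a₃ b e := by
  have hp₀ : IsProbVec (Function.update p e 0) := hp.update e le_rfl zero_le_one
  rw [H2_eq_root p hends o a₂ b, ← covUm_eq_root p hends o a₂]
  have hc := covUm_root_add_oH_deficit_nonneg p hp hends o a₂
  have hB2 := B2_nonneg_root p hp hends o a₂ b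
  have hQ0 := prob_nonneg hp₀ (avoidAll ends a₂ {a₁})
  have h1 := mul_nonneg hc hsm
  nlinarith [h1, mul_nonneg hQ0 hB2]

/-- **`0 ≤ H1` at a root edge from two closed-pin inequalities**: `0 ≤ Q₀·B1 + covU₀·slackBm` and
`δ_oH·slackB₀ ≤ Q₁·Gc₀` (with `c ≥ −δ_oH` and `slackB₀ ≥ 0` theorems). -/
theorem H1_nonneg_root_of (p : E → R) (hp : IsProbVec p) (hends : ends e = s(a₁, a₃)) (o a₂ b : V)
    (hD5 : 0 ≤ prob (Function.update p e 0) (avoidAll ends a₂ {a₁}) * B1 p ends o a₁ a₂ a₃ b e +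
        covU (Function.update p e 0) ends o a₁ a₂ a₃ * slackBm p ends a₁ a₂ a₃ b e)
    (hD3 : (prob (Function.update p e 0) (PDEvent ends a₁ a₂ a₃ ∩ connEvent ends a₂ o) *
              prob (Function.update p e 0) (TEvent ends a₂ a₁ a₃) -
            prob (Function.update p e 0) (PDEvent ends a₁ a₂ a₃) *
              prob (Function.update p e 0) (TEvent ends a₂ a₁ a₃ ∩ connEvent ends a₂ o)) *
          slackB (Function.update p e 0) ends a₁ a₂ a₃ b ≤
        prob (Function.update p e 1) (avoidAll ends a₂ {a₁}) *
          Gc (Function.update p e 0) ends o a₁ a₂ a₃ b) :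
    0 ≤ H1 p ends o a₁ a₂ a₃ b e := by
  have hp₀ : IsProbVec (Function.update p e 0) := hp.update e le_rfl zero_le_one
  rw [H1_eq_root p hends o a₂ b, ← covUm_eq_root p hends o a₂]
  have hc := covUm_root_add_oH_deficit_nonneg p hp hends o a₂
  have hsl := slackB_nonneg (Function.update p e 0) hp₀ ends a₁ a₂ a₃ b
  have h1 := mul_nonneg hc hsl
  nlinarith [h1]

/-- **(HCOV⁺) across a root edge from (HCOV⁺) at the closed pin and the three closed-pin
inequalities** `0 ≤ slackBm`, `δ_oH·slackBm ≤ Q₁·B1`, `0 ≤ Q₀·B1 + covU₀·slackBm`,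
`δ_oH·slackB₀ ≤ Q₁·Gc₀`. -/
theorem HCovPlus_of_update_zero_root_of (p : E → R) (hp : IsProbVec p)
    (hends : ends e = s(a₁, a₃)) (o a₂ b : V)
    (h₀ : HCovPlus (Function.update p e 0) ends o a₁ a₂ a₃ b)
    (hsm : 0 ≤ slackBm p ends a₁ a₂ a₃ b e)
    (hC2 : (prob (Function.update p e 0) (PDEvent ends a₁ a₂ a₃ ∩ connEvent ends a₂ o) *
              prob (Function.update p e 0) (TEvent ends a₂ a₁ a₃) -
            prob (Function.update p e 0) (PDEvent ends a₁ a₂ a₃) *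
              prob (Function.update p e 0) (TEvent ends a₂ a₁ a₃ ∩ connEvent ends a₂ o)) *
          slackBm p ends a₁ a₂ a₃ b e ≤
        prob (Function.update p e 1) (avoidAll ends a₂ {a₁}) * B1 p ends o a₁ a₂ a₃ b e)
    (hD5 : 0 ≤ prob (Function.update p e 0) (avoidAll ends a₂ {a₁}) * B1 p ends o a₁ a₂ a₃ b e +
        covU (Function.update p e 0) ends o a₁ a₂ a₃ * slackBm p ends a₁ a₂ a₃ b e)
    (hD3 : (prob (Function.update p e 0) (PDEvent ends a₁ a₂ a₃ ∩ connEvent ends a₂ o) *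
              prob (Function.update p e 0) (TEvent ends a₂ a₁ a₃) -
            prob (Function.update p e 0) (PDEvent ends a₁ a₂ a₃) *
              prob (Function.update p e 0) (TEvent ends a₂ a₁ a₃ ∩ connEvent ends a₂ o)) *
          slackB (Function.update p e 0) ends a₁ a₂ a₃ b ≤
        prob (Function.update p e 1) (avoidAll ends a₂ {a₁}) *
          Gc (Function.update p e 0) ends o a₁ a₂ a₃ b) :
    HCovPlus p ends o a₁ a₂ a₃ b :=
  HCovPlus_of_update_zero_root p hp hends o a₂ b h₀
    (H1_nonneg_root_of p hp hends o a₂ b hD5 hD3) (H2_nonneg_root_of p hp hends o a₂ b hsm hC2)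

end Face

end QuarticRootCross

end Summit.Ventures.PercRepro2
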